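import Literature.NumberTheory.Rogawski1990.ArchEndoscopicCentralCurveGSide          -- ★ (3G): `finsum_delta_mul_integral_eq_sum_relabel`, `card_filter_mk_relabel_eq_of_injective`
import Literature.NumberTheory.Rogawski1990.ArchInnerTransferRegularOrbitIdentity     -- ★ `integral_comp_conj_archDiagTorus_map_symm_pi_eq_integral_pi_map_conj`
import Literature.NumberTheory.Automorphic.ArchEndoscopicStableSumTorus                -- ★ `archCongrOfEq_quasiSplitFrameTwo_symm_archDiagTorus` (the assembler's `H`-point = the Cayley point)
import Summits.HodgeConjecture.HodgeConjecture.Theorems.K2E4ArchSingularKernelWallStepLemmas   -- ★ p854846: `card_filter_forall_image_eq` (the multiplicities are `ρ`-free)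
import HarnessLib

/-!
# The REGULAR IDENTITY of the `G′`-state family of the endoscopic singular transfer at `∞`: at a `G`-regular torus datum the `Δ′`-weighted class sum of (4.3.1) in Haar currency
# IS the κ-weighted sum over global relabellings of orbit-measure states (Rogawski 1990 §4.1 (4.1.1) p. 39, §4.3 (4.3.1) p. 43, Prop. 8.2.1 (a) pp. 118–119)

Cell `pub/hodgecm-mathlib`, Track B «K2-LIT», engine K2·E4, sockets #11 `sig_K2E4ArchSingularKernel` ∕ #9 `sig_K2E4ExplicitArchSingularTransfer` (crux H413 =
`stmt-HodgeConjecture-24833`); brick G3-reg of the V2 «G′ PACKAGE» (K2E4-p11 for the assembler K2E4-p09; lands `--supports stmt-HodgeConjecture-24833`).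

WHAT.  The (reg) clause of the assembler's `G′`-package: at processed places `S = ∅` the state `B(∅, u)` must equal the right side of ★ (β)
`sum_integral_pi_eq_inv_mul_finsum_delta_comap_archSingularCurve` without `κ⁻¹`, namely `Σᶠ_{c″} T′.Δ(γ_H[u], out c″) · ∫ b(g·out c″·g⁻¹) dν` for a Haar measure `ν` on `U(diag α)_∞` and the
`H`-point `γ_H[u] = (Ψ_{Q₂}⁻¹ t(u), e₁⁻¹(diag δ))`.  **`finsum_delta_mul_integral_eq_sum_relabel_pi`** rewrites it as
`Σ_ρ N⁻¹ · T′.Δ(γ_H[u], t(ẑ∘ρ)) · (χ · ∫ Θ ↑↑(e⁻¹ o) d(⊗_v (ν_v).map conj_{diag(ẑ_v∘ρ_v)}))`, `ẑ_v = (u_v0, δ_v, u_v1)`, for per-place Haar measures `ν_v` with `ν = χ • e⁻¹_*(⊗_v ν_v)` and the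
ambient lift `Θ` of `b` — i.e. as a sum of ★ (R1-e′) states (all places regular), the shape ★ `K2E4ArchGStateStep.tendsto_deriv_gState_step` moves place by place; `N` = the ONE multiplicity
`#{σ ∣ ∀ v, σ_v(P_v) = P_v}` (★ `card_filter_mk_relabel_eq_of_injective` + ★ `card_filter_forall_image_eq`).  Ingredients: ★ (3G) `finsum_delta_mul_integral_eq_sum_relabel` at the constant
curve (speed `0`) through `ẑ`, ★ `integral_comp_conj_archDiagTorus_map_symm_pi_eq_integral_pi_map_conj` (Fubini over the places), `integral_smul_measure`, and ★
`archCongrOfEq_quasiSplitFrameTwo_symm_archDiagTorus` (the assembler's `H`-point is the Cayley point of ★ (3G)).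
HONEST LABEL: HC_CM is proved only modulo the 7 printed citations (2 remaining named inputs: hLiu418 = stmt-HodgeConjecture-24832, h413 = stmt-HodgeConjecture-24833) until rung 0
closes; bookkeeping, pays nothing by itself.

## References
* [Rogawski1990] J. D. Rogawski, *Automorphic Representations of Unitary Groups in Three Variables*, Ann. of Math. Stud. 123 (1990), §4.1 (4.1.1) p. 39; §4.3 (4.3.1) p. 43;
  Prop. 8.2.1 (a) pp. 118–119; §14.5 p. 238.
* [BorelJacquet1979] A. Borel, H. Jacquet, *Automorphic forms and automorphic representations*, PSPM 33.1 (1979), §4.1.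
* [Folland1995] G. B. Folland, *A Course in Abstract Harmonic Analysis* (1995), §2.6 (2.52).
-/

set_option autoImplicit false
set_option linter.dupNamespace false  -- the cell's namespace convention `Summit.HodgeConjecture.HodgeConjecture.Cruxes.H413.<File>` repeats the summit = problem name

noncomputable section

open MeasureTheory Measure Filter Topology NumberField NumberField.InfinitePlace NumberField.mixedEmbedding Equiv Function Set
open Literature.MeasureTheory.Group Literature.NumberTheory.Automorphic Literature.NumberTheory.Automorphic.UnitaryGroup
open Literature.LinearAlgebra.Matrix Literature.NumberTheory.Rogawski1990
open scoped Matrix MatrixGroups Matrix.Norms.Operator ContDiff ENNReal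

namespace Summit.HodgeConjecture.HodgeConjecture.Cruxes.H413.K2E4ArchGStateReg

variable (L : Type) [Field L] [NumberField L] [IsCMField L] (α : Fin 3 → L)
  [MeasurableSpace (arch (↥(maximalRealSubfield L)) L (IsCMField.complexConj L) 3 (Matrix.diagonal α))]
  [BorelSpace (arch (↥(maximalRealSubfield L)) L (IsCMField.complexConj L) 3 (Matrix.diagonal α))]

open scoped Classical in
/-- **THE REGULAR IDENTITY (the `G′`-state at `S = ∅`).**  For per-place Haar measures `νw`, a Haar measure `ν = χ • e⁻¹_*(⊗_v νw v)` on `U(diag α)_∞`, a transfer factor `T`, a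
continuous ambient `Θ` lifting `b`, the frozen `U(Φ₁)`-angles `δ` and a torus datum `u` with `(u_v0, δ_v, u_v1)` pairwise distinct at every place:
`Σᶠ_{c″} T.Δ(γ_H[u], out c″)·∫ b(g·out c″·g⁻¹) dν = Σ_ρ N⁻¹ · T.Δ(γ_H[u], t(ẑ∘ρ)) · (χ · ∫ Θ ↑↑(e⁻¹ o) d(⊗_v (νw v).map conj_{diag(ẑ_v∘ρ_v)}))`, `γ_H[u] = (Ψ_{Q₂}⁻¹ t(u), e₁⁻¹(diag δ))`.
[cite: Rogawski1990, §4.1 (4.1.1) p. 39; §4.3 (4.3.1) p. 43; Prop. 8.2.1 (a) p. 119] [cite: BorelJacquet1979, §4.1] -/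
theorem finsum_delta_mul_integral_eq_sum_relabel_pi
    (hα : ∀ i, α i ≠ 0) (hherm : ∀ i, (IsCMField.complexConj L (α i) : L) = α i)
    [∀ v : {w : InfinitePlace L // IsComplex w}, MeasurableSpace (archLocal L 3 (Matrix.diagonal α) v)]
    [∀ v : {w : InfinitePlace L // IsComplex w}, BorelSpace (archLocal L 3 (Matrix.diagonal α) v)]
    (νw : ∀ v : {w : InfinitePlace L // IsComplex w}, Measure (archLocal L 3 (Matrix.diagonal α) v)) [∀ v, (νw v).IsHaarMeasure]
    (ν : Measure (arch (↥(maximalRealSubfield L)) L (IsCMField.complexConj L) 3 (Matrix.diagonal α))) [ν.IsMulRightInvariant]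
    (χ : ℝ≥0∞) (hν : ν = χ • (Measure.pi νw).map (archPiEquivCM 3 L (Matrix.diagonal α)).symm)
    (T : ArchTransferFactor L (Matrix.diagonal α))
    (Θ : Matrix (Fin 3) (Fin 3) (mixedSpace L) → ℂ) (hΘ : Continuous Θ)
    (b : arch (↥(maximalRealSubfield L)) L (IsCMField.complexConj L) 3 (Matrix.diagonal α) → ℂ)
    (hb : ∀ g, b g = Θ ((g : GL (Fin 3) (mixedSpace L)) : Matrix (Fin 3) (Fin 3) (mixedSpace L)))
    (δ : {w : InfinitePlace L // IsComplex w} → Circle) (u : {w : InfinitePlace L // IsComplex w} → Fin 2 → Circle)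
    (hu : ∀ v, Function.Injective (![u v 0, δ v, u v 1] : Fin 3 → Circle)) :
    ∑ᶠ c'' : ConjClasses (arch (↥(maximalRealSubfield L)) L (IsCMField.complexConj L) 3 (Matrix.diagonal α)),
        T.Δ ((unitaryGroupOfFormCongrOfEq (conjMixed (↥(maximalRealSubfield L)) L (IsCMField.complexConj L))
                (Matrix.GeneralLinearGroup.map (mixedEmbedding L) (Matrix.GeneralLinearGroup.mkOfDetNeZero !![(1 : L), 1; 1, -1] (det_quasiSplitFrameTwo_ne_zero L)))
                (archFormOf L 2 (Matrix.diagonal ![(2 : L)⁻¹, -(2 : L)⁻¹])) (archFormOf L 2 (Matrix.of fun i j : Fin 2 => if i.val + j.val + 1 = 2 then (1 : L) else 0))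
                (formCongr_map_mixedEmbedding_archFormOf_eq L (formCongr_quasiSplitFrameTwo_diagonal L))).symm
                (archDiagTorus L 2 ![(2 : L)⁻¹, -(2 : L)⁻¹] u),
              (archPiEquivCM 1 L (Matrix.of fun i j : Fin 1 => if i.val + j.val + 1 = 1 then (1 : L) else 0)).symm fun w =>
                ⟨circleDiagonal 1 ![δ w], circleDiagonal_mem_archLocal_antidiagOne L w _⟩)
            (Quotient.out c'') *
          ∫ g, b (g * Quotient.out c'' * g⁻¹) ∂ν =
      ∑ ρ : {w : InfinitePlace L // IsComplex w} → Perm (Fin 3),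
        ((Finset.univ.filter fun τ : {w : InfinitePlace L // IsComplex w} → Perm (Fin 3) => ∀ v : {w : InfinitePlace L // IsComplex w},
            (Finset.univ.filter fun i : Fin 3 => 0 < (v.1.embedding (α i)).re).image ⇑(τ v) =
              (Finset.univ.filter fun i : Fin 3 => 0 < (v.1.embedding (α i)).re)).card : ℂ)⁻¹ *
          (T.Δ ((unitaryGroupOfFormCongrOfEq (conjMixed (↥(maximalRealSubfield L)) L (IsCMField.complexConj L))
                (Matrix.GeneralLinearGroup.map (mixedEmbedding L) (Matrix.GeneralLinearGroup.mkOfDetNeZero !![(1 : L), 1; 1, -1] (det_quasiSplitFrameTwo_ne_zero L)))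
                (archFormOf L 2 (Matrix.diagonal ![(2 : L)⁻¹, -(2 : L)⁻¹])) (archFormOf L 2 (Matrix.of fun i j : Fin 2 => if i.val + j.val + 1 = 2 then (1 : L) else 0))
                (formCongr_map_mixedEmbedding_archFormOf_eq L (formCongr_quasiSplitFrameTwo_diagonal L))).symm
                (archDiagTorus L 2 ![(2 : L)⁻¹, -(2 : L)⁻¹] u),
              (archPiEquivCM 1 L (Matrix.of fun i j : Fin 1 => if i.val + j.val + 1 = 1 then (1 : L) else 0)).symm fun w =>
                ⟨circleDiagonal 1 ![δ w], circleDiagonal_mem_archLocal_antidiagOne L w _⟩)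
              (archDiagTorus L 3 α fun v => (![u v 0, δ v, u v 1] : Fin 3 → Circle) ∘ ⇑(ρ v)) *
            ((χ.toReal : ℂ) *
              ∫ o, Θ ((((archPiEquivCM 3 L (Matrix.diagonal α)).symm o : arch (↥(maximalRealSubfield L)) L (IsCMField.complexConj L) 3 (Matrix.diagonal α)) :
                  GL (Fin 3) (mixedSpace L)) : Matrix (Fin 3) (Fin 3) (mixedSpace L))
                ∂(Measure.pi fun v : {w : InfinitePlace L // IsComplex w} => (νw v).map fun y : archLocal L 3 (Matrix.diagonal α) v =>
                  y * (⟨circleDiagonal 3 ((![u v 0, δ v, u v 1] : Fin 3 → Circle) ∘ ⇑(ρ v)),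
                    circleDiagonal_mem_archLocal_diagonal L 3 α v _⟩ : archLocal L 3 (Matrix.diagonal α) v) * y⁻¹))) := by
  classical
  have hreal : ∀ (v : {w : InfinitePlace L // IsComplex w}) (i : Fin 3), (v.1.embedding (α i)).im = 0 :=
    fun v i => im_embedding_eq_zero_of_complexConj_eq L v (hherm i)
  -- ★ (3G) at the constant curve through `ẑ = (u₀, δ, u₁)` (speed `0`, parameter `0`)
  have key := finsum_delta_mul_integral_eq_sum_relabel L α (fun v => (![u v 0, δ v, u v 1] : Fin 3 → Circle)) (fun _ => (0 : ℝ)) _ _ rfl rfl T ν b hα hherm 0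
  simp only [mul_zero, Circle.exp_zero, mul_one, Matrix.cons_val_zero, Matrix.cons_val_one, Matrix.cons_val_two, Matrix.head_cons,
    Matrix.tail_cons] at key
  -- the assembler's `H`-point `(Ψ⁻¹ t₂(u), e₁⁻¹ diag δ)` IS the Cayley point of ★ (3G)
  have hpt : (unitaryGroupOfFormCongrOfEq (conjMixed (↥(maximalRealSubfield L)) L (IsCMField.complexConj L))
        (Matrix.GeneralLinearGroup.map (mixedEmbedding L) (Matrix.GeneralLinearGroup.mkOfDetNeZero !![(1 : L), 1; 1, -1] (det_quasiSplitFrameTwo_ne_zero L)))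
        (archFormOf L 2 (Matrix.diagonal ![(2 : L)⁻¹, -(2 : L)⁻¹])) (archFormOf L 2 (Matrix.of fun i j : Fin 2 => if i.val + j.val + 1 = 2 then (1 : L) else 0))
        (formCongr_map_mixedEmbedding_archFormOf_eq L (formCongr_quasiSplitFrameTwo_diagonal L))).symm
        (archDiagTorus L 2 ![(2 : L)⁻¹, -(2 : L)⁻¹] u) =
      (archPiEquivCM 2 L (Matrix.of fun i j : Fin 2 => if i.val + j.val + 1 = 2 then (1 : L) else 0)).symm fun w =>
        ⟨Matrix.GeneralLinearGroup.mkOfDetNeZero !![(1 : ℂ), 1; 1, -1] det_cayleyTwo_ne_zero * circleDiagonal 2 ![u w 0, u w 1] *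
            (Matrix.GeneralLinearGroup.mkOfDetNeZero !![(1 : ℂ), 1; 1, -1] det_cayleyTwo_ne_zero)⁻¹,
          cayley_conj_circleDiagonal_mem_archLocal L w _⟩ := by
    rw [archCongrOfEq_quasiSplitFrameTwo_symm_archDiagTorus]
    congr 1
  rw [hpt, key]
  refine Finset.sum_congr rfl fun ρ _ => ?_
  -- the datum `ẑ ∘ ρ` is injective at every place
  have hz : ∀ v : {w : InfinitePlace L // IsComplex w}, Function.Injective ((![u v 0, δ v, u v 1] : Fin 3 → Circle) ∘ ⇑(ρ v)) :=
    fun v => (hu v).comp (ρ v).injective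
  -- the multiplicity is the `ρ`-free number `#{τ ∣ ∀ v, τ_v(P_v) = P_v}`
  have hfun : (fun w : {w : InfinitePlace L // IsComplex w} => (fun i : Fin 3 => (![u w 0, δ w, u w 1] : Fin 3 → Circle) i) ∘ ⇑(ρ w)) =
      fun v => (![u v 0, δ v, u v 1] : Fin 3 → Circle) ∘ ⇑(ρ v) := rfl
  rw [card_filter_mk_relabel_eq_of_injective L α hα hreal (fun v => (![u v 0, δ v, u v 1] : Fin 3 → Circle)) hu ρ,
    K2E4ArchSingularKernelWallStepLemmas.card_filter_forall_image_eq
      (fun v : {w : InfinitePlace L // IsComplex w} => Finset.univ.filter fun i : Fin 3 => 0 < (v.1.embedding (α i)).re) ρ, hfun]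
  congr 2
  -- the integral: Haar currency `ν = χ • e⁻¹_*(⊗ ν_v)`, the ambient lift `Θ`, and ★ Fubini over the places
  have hbΘ : b = fun g : arch (↥(maximalRealSubfield L)) L (IsCMField.complexConj L) 3 (Matrix.diagonal α) =>
      Θ ((g : GL (Fin 3) (mixedSpace L)) : Matrix (Fin 3) (Fin 3) (mixedSpace L)) := funext hb
  rw [hν, integral_smul_measure, hbΘ, Complex.real_smul]
  beta_reduce
  rw [integral_comp_conj_archDiagTorus_map_symm_pi_eq_integral_pi_map_conj L 3 α hα νw hz Θ hΘ]

end Summit.HodgeConjecture.HodgeConjecture.Cruxes.H413.K2E4ArchGStateReg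

end
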